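import Summits.BirchSwinnertonDyer.Rank1Residual.X11b.FittingVersusCharIdeal
import Literature.AlgebraicGeometry.Resolution.RegularLocalRingsProofs
import Mathlib.RingTheory.PowerSeries.WeierstrassPreparation
import Mathlib.RingTheory.Polynomial.Quotient
import Mathlib.RingTheory.Ideal.AssociatedPrime.Finiteness
import Mathlib.LinearAlgebra.FreeModule.PID
import Mathlib.Algebra.Category.ModuleCat.Projective
import HarnessLib

/-!
# Lemma 2.2's algebraic content: over `Λ = ℤ_p⟦T⟧`, a finite torsion module with no nonzero
# submodule of finite length has `Fitt_Λ = char_Λ` (cell `b2b-bsdres`, X11b route R1)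

HONEST FRAMING (cell `b2b-bsdres`, run/shared/lean/b2b/bsd-rank1-residual/, verbatim in every
file): the goal of the cell is to DELETE the COMBINATION-SHAPED residual classes of the
Birch–Swinnerton-Dyer formula for ALL analytic-rank `≤ 1` elliptic curves over `ℚ` — "full BSD
formula for every rank `≤ 1` curve in class `C`" assembled STRICTLY from published theorems — so
that the rank-`≤ 1` remainder becomes exactly the CONSTRUCTION-SHAPED classes, which are TYPED
(missing-input `Prop`s), NOT attempted. This is not "finishing BSD". Sub-cell
`b2b-bsdres-multr1-p1` (X11b via the re-proof of Castella 2018 Thm. A along the author's erratum):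
a RESEARCH ROUTE; no claim beyond the stated class; X11b stays CONSTRUCTION-SHAPED; nothing here
changes a label. THEOREMS ONLY (no definition, no named fact, no `sorry`); pure commutative algebra.

The erratum (proof of Thm. 1.1, p. 4) uses its Lemma 2.2 — "`Sel^Σ_𝔭(K, M_g)` has no proper
finite index `Λ_𝒪`-submodules", i.e. the Pontryagin dual `X^Σ_ac(A_g)` has no nonzero finite
submodule — only through "by Lemma 2.2 we know that `Ch_Λ(X^Σ_ac(A_{g_m})) = Fitt_Λ(X^Σ_ac(A_{g_m}))`"
([Ski16] § 3.1 (f): "`X^Σ(f_m)` has no nonzero finite-order `Λ_𝒪`-submodules, so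
`F^Σ(f_m) = Ch^Σ(f_m)`", Lemma of § 2.3). THIS FILE proves that implication over the tree's
`Λ = ℤ_p⟦T⟧`: for a finite torsion `Λ`-module `M` all of whose submodules of finite length vanish
(for finite `Λ`-modules: finite length ⇔ finite cardinality ⇔ pseudo-null),
`Fitt_Λ(M)` is principal (`fittingIdeal_zero_isPrincipal_of_forall_length`), hence
(`fittingIdeal_zero_eq_charIdeal_iff_isPrincipal`, `FittingVersusCharIdeal.lean`) equal to
`char_Λ(M)` (`fittingIdeal_zero_eq_charIdeal_of_forall_length`), and `char(N) = (L)` gives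
`Fitt₀(N) = (L)` (`fittingIdeal_zero_eq_span_of_charIdeal_eq_span_of_forall_length`) — the
hypothesis `hF` of `isTorsion_and_charIdeal_eq_of_congruences` in its printed form.

Proof (the classical one behind [NSW] (5.3.19) (i), "no nonzero finite submodule ⇔ `pd_Λ ≤ 1`"):
(1) `𝔪 = (p, T)` is not an associated prime of `M` (an embedding `Λ/𝔪 ↪ M` has image of length
`1`); the elements `x_k = T − p^k`, `k ≥ 1`, generate pairwise distinct height-one primes and an
associated prime `≠ 𝔪` containing `x_k` equals `(x_k)` (`Λ/(x_k) ≅ ℤ_p` is a PID), so — the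
associated primes being finitely many (Mathlib `associatedPrimes.finite`) and their union being
the zero-divisors on `M` — some `x_k` is `M`-regular (`exists_isSMulRegular_X_sub_C_pow`);
(2) `Λ/(x_k) ≅ ℤ_p` by Weierstrass division (Mathlib's `Polynomial.IsDistinguishedAt.algEquivQuotient`
and `Polynomial.quotientSpanXSubCAlgEquiv`) is a PID, over which every finite module has projective
dimension `≤ 1` (submodules of free modules are free, `Submodule.nonempty_basis_of_pid`);
(3) Matsumura § 18 Lemma 2 in the tree's form `hasProjectiveDimensionLE_quotSMulTop_iff`
(`pd_Λ M ≤ n ↔ pd_{Λ/x}(M/xM) ≤ n` for `x ∈ 𝔪` regular on `Λ` and on `M`) gives `pd_Λ M ≤ 1`;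
(4) so the relation module of a presentation `Λⁿ ↠ M` is projective, hence free (local ring), of
rank `n` (`M` is torsion), and `Fitt_Λ(M) = (det)` of the square relation matrix
(`Module.fittingIdeal_zero_eq_span_det_of_square_presentation`). Universe note: `M : Type`
(universe `0`, where the arithmetic objects live) because the projective-dimension API is
categorical (`ModuleCat.{0} Λ`).

References: F. Castella, Erratum, Lemma 2.2 and p. 4 [Castella2018Erratum]; C. Skinner, Pacific J.
Math. 283 (2016), Prop. 2.3.3 (ii), § 2.3, § 3.1 (f) [Skinner2016PacificMC]; J. Neukirch,
A. Schmidt, K. Wingberg, *Cohomology of Number Fields*, (5.3.19) [NeukirchSchmidtWingberg2008];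
H. Matsumura, *Commutative Ring Theory*, § 18 Lemma 2 [Matsumura1987]; L. Washington, GTM 83,
Prop. 7.2 and § 13.2 [Washington1997].
-/

noncomputable section

open Literature.RingTheory.FittingIdeal Literature.NumberTheory.EllipticCurves
  Literature.NumberTheory.EllipticCurves.Module Literature.AlgebraicGeometry.Resolution
  CategoryTheory IsLocalRing Polynomial

namespace Summit.BirchSwinnertonDyer.Rank1Residual.X11b.CongruenceLimit

variable (p : ℕ) [Fact p.Prime]

/-- The elements `x_k = T − p^k ∈ Λ = ℤ_p⟦T⟧` (as coerced polynomials). -/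
local notation3 "𝔵[" k "]" =>
  ((Polynomial.X - Polynomial.C ((p : ℤ_[p]) ^ k) : ℤ_[p][X]) : IwasawaAlgebra p)

/-! ### The elements `x_k = T − p^k` -/

/-- `X − p^k` (`k ≥ 1`) is a distinguished polynomial over `ℤ_p`. [folklore] -/
theorem isDistinguishedAt_X_sub_C_pow {k : ℕ} (hk : 1 ≤ k) :
    (X - C ((p : ℤ_[p]) ^ k) : ℤ_[p][X]).IsDistinguishedAt (maximalIdeal ℤ_[p]) := by
  refine ⟨⟨fun {i} hi => ?_⟩, monic_X_sub_C _⟩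
  rw [natDegree_X_sub_C] at hi
  have hi0 : i = 0 := by omega
  subst hi0
  rw [coeff_sub, coeff_X_zero, coeff_C_zero, zero_sub, neg_mem_iff, mem_maximalIdeal,
    mem_nonunits_iff, isUnit_pow_iff (by omega)]
  exact PadicInt.irreducible_p.not_isUnit

/-- `x_k ≠ 0`. [folklore] -/
theorem X_sub_C_pow_ne_zero (k : ℕ) : 𝔵[k] ≠ 0 :=
  IwasawaAlgebra.coe_ne_zero_of_monic p (monic_X_sub_C _)

/-- `x_k ∈ 𝔪_Λ` for `k ≥ 1` (its constant coefficient `−p^k` is not a unit). [folklore] -/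
theorem X_sub_C_pow_mem_maximalIdeal {k : ℕ} (hk : 1 ≤ k) :
    𝔵[k] ∈ maximalIdeal (IwasawaAlgebra p) := by
  rw [Polynomial.coe_sub, Polynomial.coe_X, Polynomial.coe_C, mem_maximalIdeal, mem_nonunits_iff,
    PowerSeries.isUnit_iff_constantCoeff, map_sub, PowerSeries.constantCoeff_X,
    PowerSeries.constantCoeff_C, zero_sub, IsUnit.neg_iff, isUnit_pow_iff (by omega)]
  exact PadicInt.irreducible_p.not_isUnit

/-- **Weierstrass division: `Λ/(T − p^k) ≅ ℤ_p`** (`T ↦ p^k`; Mathlib's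
`Polynomial.IsDistinguishedAt.algEquivQuotient`, `Polynomial.quotientSpanXSubCAlgEquiv`), sending
the class of a polynomial `q` to `q(p^k)`. Stated as an existence to keep the file definition-free.
[cite: Washington1997, Prop. 7.2 (Weierstrass division)] -/
theorem exists_algEquiv_quotient_X_sub_C_pow {k : ℕ} (hk : 1 ≤ k) :
    ∃ e : (IwasawaAlgebra p ⧸ Ideal.span {𝔵[k]}) ≃ₐ[ℤ_[p]] ℤ_[p],
      ∀ q : ℤ_[p][X], e (Ideal.Quotient.mk _ (q : IwasawaAlgebra p)) = q.eval ((p : ℤ_[p]) ^ k) := by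
  refine ⟨(isDistinguishedAt_X_sub_C_pow p hk).algEquivQuotient.symm.trans
    (quotientSpanXSubCAlgEquiv ((p : ℤ_[p]) ^ k)), fun q => ?_⟩
  have happly : (isDistinguishedAt_X_sub_C_pow p hk).algEquivQuotient (Ideal.Quotient.mk _ q) =
      Ideal.Quotient.mk _ (q : IwasawaAlgebra p) := rfl
  rw [AlgEquiv.trans_apply, ← happly, AlgEquiv.symm_apply_apply, quotientSpanXSubCAlgEquiv_mk]

/-- `Λ/(x_k)` is a principal ideal domain. [folklore] -/
theorem isPrincipalIdealRing_quotient {k : ℕ} (hk : 1 ≤ k) :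
    IsPrincipalIdealRing (IwasawaAlgebra p ⧸ Ideal.span {𝔵[k]}) := by
  obtain ⟨e, -⟩ := exists_algEquiv_quotient_X_sub_C_pow p hk
  exact IsPrincipalIdealRing.of_surjective e.symm.toRingEquiv.toRingHom e.symm.surjective

/-- `Λ/(x_k)` is a domain (so `(x_k)` is prime). [folklore] -/
theorem isDomain_quotient {k : ℕ} (hk : 1 ≤ k) : IsDomain (IwasawaAlgebra p ⧸ Ideal.span {𝔵[k]}) := by
  obtain ⟨e, -⟩ := exists_algEquiv_quotient_X_sub_C_pow p hk
  exact e.toMulEquiv.isDomain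

/-- The ideals `(x_k)`, `k ≥ 1`, are pairwise distinct: `x_k ∈ (x_j)` forces `j = k`
(evaluate at `T = p^j`). [folklore] -/
theorem eq_of_X_sub_C_pow_mem_span {j k : ℕ} (hj : 1 ≤ j) (h : 𝔵[k] ∈ Ideal.span {𝔵[j]}) :
    j = k := by
  obtain ⟨e, he⟩ := exists_algEquiv_quotient_X_sub_C_pow p hj
  have h0 : Ideal.Quotient.mk (Ideal.span {𝔵[j]}) 𝔵[k] = 0 := Ideal.Quotient.eq_zero_iff_mem.mpr h
  have h1 := he (X - C ((p : ℤ_[p]) ^ k))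
  rw [h0, map_zero, eval_sub, eval_X, eval_C, eq_comm, sub_eq_zero] at h1
  exact pow_injective_of_not_isUnit PadicInt.irreducible_p.not_isUnit
    PadicInt.irreducible_p.ne_zero h1

/-- A prime `𝔮 ≠ 𝔪` of `Λ` containing `x_k` is `(x_k)`: in the PID `Λ/(x_k) ≅ ℤ_p` the image of
`𝔮` is a prime, hence `0` or maximal, and the latter would make `𝔮` maximal. [folklore] -/
theorem eq_span_of_mem_of_ne_maximalIdeal {k : ℕ} (hk : 1 ≤ k) {𝔮 : Ideal (IwasawaAlgebra p)}
    [𝔮.IsPrime] (hx : 𝔵[k] ∈ 𝔮) (hne : 𝔮 ≠ maximalIdeal (IwasawaAlgebra p)) :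
    𝔮 = Ideal.span {𝔵[k]} := by
  haveI := isPrincipalIdealRing_quotient p hk
  haveI := isDomain_quotient p hk
  set I : Ideal (IwasawaAlgebra p) := Ideal.span {𝔵[k]} with hI
  have hle : I ≤ 𝔮 := (Ideal.span_singleton_le_iff_mem _).mpr hx
  have hker : RingHom.ker (Ideal.Quotient.mk I) ≤ 𝔮 := by rw [Ideal.mk_ker]; exact hle
  haveI hprime : (𝔮.map (Ideal.Quotient.mk I)).IsPrime :=
    Ideal.map_isPrime_of_surjective Ideal.Quotient.mk_surjective hker
  by_cases hbot : 𝔮.map (Ideal.Quotient.mk I) = ⊥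
  · rw [Ideal.map_eq_bot_iff_le_ker, Ideal.mk_ker] at hbot
    exact le_antisymm hbot hle
  · exfalso
    have hmax : (𝔮.map (Ideal.Quotient.mk I)).IsMaximal := IsPrime.to_maximal_ideal hbot
    have hcomap := Ideal.comap_isMaximal_of_surjective (Ideal.Quotient.mk I)
      Ideal.Quotient.mk_surjective (K := 𝔮.map (Ideal.Quotient.mk I))
    rw [Ideal.comap_map_of_surjective _ Ideal.Quotient.mk_surjective, ← RingHom.ker_eq_comap_bot,
      sup_eq_left.mpr hker] at hcomap
    exact hne (IsLocalRing.eq_maximalIdeal hcomap)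

/-! ### A regular element of the form `T − p^k` -/

/-- **An `M`-regular element `x_k = T − p^k`.** If every submodule of finite length of the finite
`Λ`-module `M` is zero, then `𝔪 ∉ Ass(M)` (an embedding `Λ/𝔪 ↪ M` has image of length `1`), every
associated prime containing some `x_k` is `(x_k)`, these are pairwise distinct, `Ass(M)` is finite
(`associatedPrimes.finite`) and its union is the set of zero-divisors on `M`
(`biUnion_associatedPrimes_eq_zero_divisors`); so some `x_k`, `k ≥ 1`, is `M`-regular.
[cite: Matsumura1987, Thm. 6.1 (ii) and Thm. 6.5 (i) (zero-divisors = union of the finitely many associated primes)] -/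
theorem exists_isSMulRegular_X_sub_C_pow (M : Type*) [AddCommGroup M]
    [Module (IwasawaAlgebra p) M] [Module.Finite (IwasawaAlgebra p) M]
    (hM : ∀ N : Submodule (IwasawaAlgebra p) M, Module.length (IwasawaAlgebra p) N ≠ ⊤ → N = ⊥) :
    ∃ k : ℕ, 1 ≤ k ∧ IsSMulRegular M 𝔵[k] := by
  classical
  set Λ := IwasawaAlgebra p
  -- `𝔪` is not an associated prime
  have hmax : maximalIdeal Λ ∉ associatedPrimes Λ M := by
    intro hmem
    rw [AssociatedPrimes.mem_iff, isAssociatedPrime_iff_exists_injective_linearMap] at hmem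
    obtain ⟨-, f, hf⟩ := hmem
    haveI : IsSimpleModule Λ (Λ ⧸ maximalIdeal Λ) :=
      isSimpleModule_iff_isCoatom.mpr (maximalIdeal.isMaximal Λ).out
    have hlen : Module.length Λ (LinearMap.range f) = 1 := by
      rw [← (LinearEquiv.ofInjective f hf).length_eq]
      exact Module.length_eq_one _ _
    have hbot := hM (LinearMap.range f) (by rw [hlen]; exact ENat.one_ne_top)
    have h1 : f 1 ∈ LinearMap.range f := LinearMap.mem_range_self f 1
    rw [hbot, Submodule.mem_bot] at h1
    exact one_ne_zero (hf (by rw [h1, map_zero]))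
  -- the bad exponents inject into the finite set of associated primes
  have hfin := associatedPrimes.finite Λ M
  set bad : Set ℕ := {k | 1 ≤ k ∧ ¬ IsSMulRegular M 𝔵[k]} with hbad
  have hmem : ∀ k ∈ bad, Ideal.span {𝔵[k]} ∈ associatedPrimes Λ M := by
    rintro k ⟨hk, hreg⟩
    rw [isSMulRegular_iff_right_eq_zero_of_smul] at hreg
    push Not at hreg
    obtain ⟨m, hm, hm0⟩ := hreg
    have hzd : (𝔵[k] : Λ) ∈ {r : Λ | ∃ x : M, x ≠ 0 ∧ r • x = 0} := ⟨m, hm0, hm⟩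
    rw [← biUnion_associatedPrimes_eq_zero_divisors] at hzd
    obtain ⟨𝔮, h𝔮, hx⟩ := Set.mem_iUnion₂.mp hzd
    haveI := (AssociatedPrimes.mem_iff.mp h𝔮).isPrime
    have hne : 𝔮 ≠ maximalIdeal Λ := fun h => hmax (h ▸ h𝔮)
    rwa [eq_span_of_mem_of_ne_maximalIdeal p hk hx hne] at h𝔮
  have hinj : Set.InjOn (fun k : ℕ => Ideal.span {𝔵[k]}) bad := by
    rintro j ⟨hj, -⟩ k ⟨-, -⟩ hjk
    have hjk' : Ideal.span {𝔵[j]} = Ideal.span {𝔵[k]} := hjk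
    exact eq_of_X_sub_C_pow_mem_span p hj (by rw [hjk']; exact Ideal.mem_span_singleton_self _)
  have hbadfin : bad.Finite :=
    Set.Finite.of_finite_image (hfin.subset (by rintro _ ⟨k, hk, rfl⟩; exact hmem k hk)) hinj
  -- pick a good exponent
  obtain ⟨k, hk1, hkbad⟩ : ((Set.Ici 1 : Set ℕ) \ bad).Nonempty :=
    ((Set.Ici_infinite 1).sdiff hbadfin).nonempty
  refine ⟨k, hk1, ?_⟩
  by_contra hreg
  exact hkbad ⟨hk1, hreg⟩

/-! ### Projective dimension `≤ 1` -/

/-- Over a principal ideal domain every finite module has projective dimension `≤ 1`: the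
relation module of a presentation `Aⁿ ↠ N` is a submodule of a free module, hence free
(`Submodule.nonempty_basis_of_pid`). [folklore] -/
theorem hasProjectiveDimensionLE_one_of_isPrincipalIdealRing {A : Type} [CommRing A] [IsDomain A]
    [IsPrincipalIdealRing A] (N : Type) [AddCommGroup N] [Module A N] [Module.Finite A N] :
    HasProjectiveDimensionLE (ModuleCat.of A N) 1 := by
  obtain ⟨n, s, hs⟩ := Module.Finite.exists_fin (R := A) (M := N)
  let f : (Fin n → A) →ₗ[A] N := Fintype.linearCombination A s
  have hf : Function.Surjective f := by
    rw [← LinearMap.range_eq_top, Fintype.range_linearCombination, hs]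
  have hS := LinearMap.shortExact_shortComplexKer hf
  haveI : Projective f.shortComplexKer.X₂ := ModuleCat.projective_of_free (Pi.basisFun A (Fin n))
  obtain ⟨m, ⟨b⟩⟩ := Submodule.nonempty_basis_of_pid (Pi.basisFun A (Fin n)) (LinearMap.ker f)
  haveI : Projective f.shortComplexKer.X₁ := ModuleCat.projective_of_free b
  change HasProjectiveDimensionLT f.shortComplexKer.X₃ (0 + 2)
  rw [hS.hasProjectiveDimensionLT_X₃_iff 0 inferInstance]
  infer_instance

/-- **`pd_Λ M ≤ 1` for a finite `Λ`-module with no nonzero submodule of finite length**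
([NSW] (5.3.19) (i), direction ⇒): with the `M`-regular `x_k = T − p^k ∈ 𝔪` of
`exists_isSMulRegular_X_sub_C_pow`, `Λ/(x_k) ≅ ℤ_p` is a PID so `pd_{Λ/x_k}(M/x_kM) ≤ 1`, and
Matsumura § 18 Lemma 2 (`hasProjectiveDimensionLE_quotSMulTop_iff`) transfers this to `Λ`.
[cite: NeukirchSchmidtWingberg2008, (5.3.19) (i)] [cite: Matsumura1987, §18 Lemma 2] -/
theorem hasProjectiveDimensionLE_one_of_forall_length (M : Type) [AddCommGroup M]
    [Module (IwasawaAlgebra p) M] [Module.Finite (IwasawaAlgebra p) M]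
    (hM : ∀ N : Submodule (IwasawaAlgebra p) M, Module.length (IwasawaAlgebra p) N ≠ ⊤ → N = ⊥) :
    HasProjectiveDimensionLE (ModuleCat.of (IwasawaAlgebra p) M) 1 := by
  obtain ⟨k, hk, hreg⟩ := exists_isSMulRegular_X_sub_C_pow p M hM
  have reg1 : IsSMulRegular (IwasawaAlgebra p) 𝔵[k] :=
    (IsRegular.of_ne_zero (X_sub_C_pow_ne_zero p k)).left.isSMulRegular
  haveI := isPrincipalIdealRing_quotient p hk
  haveI := isDomain_quotient p hk
  haveI : Module.Finite (IwasawaAlgebra p ⧸ Ideal.span {𝔵[k]})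
      (QuotSMulTop 𝔵[k] (ModuleCat.of (IwasawaAlgebra p) M)) :=
    Module.Finite.of_restrictScalars_finite (IwasawaAlgebra p) _ _
  exact (hasProjectiveDimensionLE_quotSMulTop_iff (ModuleCat.of (IwasawaAlgebra p) M) 𝔵[k] reg1
    hreg (X_sub_C_pow_mem_maximalIdeal p hk) 1).mpr
    (hasProjectiveDimensionLE_one_of_isPrincipalIdealRing
      (QuotSMulTop 𝔵[k] (ModuleCat.of (IwasawaAlgebra p) M)))

/-! ### A square presentation, and the order ideal -/

/-- **`pd ≤ 1` ⇒ the relation module of a finite presentation is free** (local ring): for a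
surjection `f : Rⁿ ↠ M` with `pd_R M ≤ 1`, `ker f` is projective
(`hasProjectiveDimensionLT_X₃_iff`), hence free (`Module.free_of_flat_of_isLocalRing`).
[cite: Matsumura1987, Thm. 2.5 (finite projective modules over local rings are free)] -/
theorem free_ker_of_hasProjectiveDimensionLE_one {R : Type} [CommRing R] [IsNoetherianRing R]
    [IsLocalRing R] {M : Type} [AddCommGroup M] [Module R M] {n : ℕ}
    (f : (Fin n → R) →ₗ[R] M) (hf : Function.Surjective f)
    (hpd : HasProjectiveDimensionLE (ModuleCat.of R M) 1) :
    Module.Free R (LinearMap.ker f) := by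
  have hS := LinearMap.shortExact_shortComplexKer hf
  haveI : Projective f.shortComplexKer.X₂ := ModuleCat.projective_of_free (Pi.basisFun R (Fin n))
  have hK : HasProjectiveDimensionLT f.shortComplexKer.X₁ (0 + 1) :=
    (hS.hasProjectiveDimensionLT_X₃_iff 0 inferInstance).mp hpd
  have hKproj : Projective f.shortComplexKer.X₁ :=
    (projective_iff_hasProjectiveDimensionLT_one (X := f.shortComplexKer.X₁)).mpr hK
  haveI : Module.Projective R (LinearMap.ker f) :=
    (IsProjective.iff_projective (LinearMap.ker f)).mpr hKproj
  exact Module.free_of_flat_of_isLocalRing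

/-- **A free relation module of a torsion module has full rank**: if `f : Rⁿ ↠ M`, `M` is killed
by some `c ≠ 0` (domain `R`) and `ker f` is free, then `rank (ker f) = n` (`ker f ⊆ Rⁿ` and
`c Rⁿ ⊆ ker f`). [folklore] -/
theorem finrank_ker_eq_of_isTorsion {R : Type} [CommRing R] [IsDomain R] [IsNoetherianRing R]
    {M : Type} [AddCommGroup M] [Module R M] [Module.Finite R M] (htors : Module.IsTorsion R M)
    {n : ℕ} (f : (Fin n → R) →ₗ[R] M) [Module.Free R (LinearMap.ker f)] :
    Module.finrank R (LinearMap.ker f) = n := by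
  have h1 : Module.finrank R (LinearMap.ker f) ≤ n := by
    simpa only [Module.finrank_fin_fun] using (LinearMap.ker f).finrank_le
  obtain ⟨c, hc, hc0⟩ := Submodule.exists_mem_ne_zero_of_ne_bot
    (annihilator_ne_bot_of_isTorsion M htors)
  have hcK : ∀ v : Fin n → R, c • v ∈ LinearMap.ker f := fun v => by
    rw [LinearMap.mem_ker, map_smul]
    exact Module.mem_annihilator.mp hc _
  let g : (Fin n → R) →ₗ[R] LinearMap.ker f := LinearMap.codRestrict _ (c • LinearMap.id) hcK
  have hg : Function.Injective g := by
    intro v w hvw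
    have h : c • v = c • w := congrArg Subtype.val hvw
    exact smul_right_injective _ hc0 h
  have h2 : n ≤ Module.finrank R (LinearMap.ker f) := by
    simpa only [Module.finrank_fin_fun] using LinearMap.finrank_le_finrank_of_injective hg
  omega

/-- **`pd ≤ 1` and torsion ⇒ the order ideal is principal** (Noetherian local domain `R`): the
relation module `K` of a presentation `Rⁿ ↠ M` is free (`free_ker_of_hasProjectiveDimensionLE_one`)
of rank `n` (`finrank_ker_eq_of_isTorsion`), and `Fitt₀(M) = (det)` of the resulting square
relation matrix (`Module.fittingIdeal_zero_eq_span_det_of_square_presentation`).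
[cite: StacksProject, Tag 07Z6] -/
theorem fittingIdeal_zero_isPrincipal_of_hasProjectiveDimensionLE_one {R : Type} [CommRing R]
    [IsDomain R] [IsNoetherianRing R] [IsLocalRing R] (M : Type) [AddCommGroup M] [Module R M]
    [Module.Finite R M] (htors : Module.IsTorsion R M)
    (hpd : HasProjectiveDimensionLE (ModuleCat.of R M) 1) :
    (Module.fittingIdeal R M 0).IsPrincipal := by
  classical
  obtain ⟨n, s, hs⟩ := Module.Finite.exists_fin (R := R) (M := M)
  let f : (Fin n → R) →ₗ[R] M := Fintype.linearCombination R s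
  have hfapply : ∀ v : Fin n → R, f v = ∑ l, v l • s l := fun v =>
    Fintype.linearCombination_apply R s v
  have hf : Function.Surjective f := by
    rw [← LinearMap.range_eq_top, Fintype.range_linearCombination, hs]
  haveI : Module.Free R (LinearMap.ker f) := free_ker_of_hasProjectiveDimensionLE_one f hf hpd
  have hcard : Fintype.card (Module.Free.ChooseBasisIndex R (LinearMap.ker f)) = n := by
    rw [← Module.finrank_eq_card_chooseBasisIndex, finrank_ker_eq_of_isTorsion htors f]
  let b : Module.Basis (Fin n) R (LinearMap.ker f) :=
    (Module.Free.chooseBasis R (LinearMap.ker f)).reindex (Fintype.equivFinOfCardEq hcard)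
  -- the square relation matrix: rows = the basis vectors of `ker f`
  let P : Matrix (Fin n) (Fin n) R := fun t l => (b t : Fin n → R) l
  have hP : ∀ t, ∑ l, P t l • s l = 0 := fun t => by
    rw [← hfapply]
    exact LinearMap.mem_ker.mp (b t).2
  have hgen : ∀ ρ : Fin n → R, ∑ l, ρ l • s l = 0 → ρ ∈ Submodule.span R (Set.range P) := by
    intro ρ hρ
    have hρK : ρ ∈ LinearMap.ker f := by rw [LinearMap.mem_ker, hfapply]; exact hρ
    have hval : ρ = ∑ t, (b.repr ⟨ρ, hρK⟩ t) • (b t : Fin n → R) := by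
      have := congrArg Subtype.val (b.sum_repr ⟨ρ, hρK⟩)
      simpa only [Submodule.coe_sum, Submodule.coe_smul] using this.symm
    rw [hval]
    exact Submodule.sum_mem _ fun t _ =>
      Submodule.smul_mem _ _ (Submodule.subset_span ⟨t, rfl⟩)
  rw [Module.fittingIdeal_zero_eq_span_det_of_square_presentation s hs P hP hgen]
  exact ⟨P.det, rfl⟩

/-- **Lemma 2.2's algebraic content** ([Ski16] § 2.3 Lemma / (f); [NSW] (5.3.19)): a finite
TORSION `Λ`-module with no nonzero submodule of finite length has PRINCIPAL order ideal.
[cite: Skinner2016PacificMC, §2.3 (Lemma `F^Σ_L(f) = Ch^Σ_L(f)`) and §3.1 (f)]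
[cite: NeukirchSchmidtWingberg2008, (5.3.19)] -/
theorem fittingIdeal_zero_isPrincipal_of_forall_length (M : Type) [AddCommGroup M]
    [Module (IwasawaAlgebra p) M] [Module.Finite (IwasawaAlgebra p) M]
    (htors : Module.IsTorsion (IwasawaAlgebra p) M)
    (hM : ∀ N : Submodule (IwasawaAlgebra p) M, Module.length (IwasawaAlgebra p) N ≠ ⊤ → N = ⊥) :
    (Module.fittingIdeal (IwasawaAlgebra p) M 0).IsPrincipal :=
  fittingIdeal_zero_isPrincipal_of_hasProjectiveDimensionLE_one M htors
    (hasProjectiveDimensionLE_one_of_forall_length p M hM)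

/-- **`Fitt_Λ(M) = char_Λ(M)` for a finite torsion `Λ`-module with no nonzero submodule of finite
length** — the statement "`Ch = Fitt`" that the erratum takes from its Lemma 2.2 and [Ski16] from
Prop. 2.3.3 (ii), proved for `Λ = ℤ_p⟦T⟧`.
[cite: Castella2018Erratum, proof of Thm. 1.1 (p. 4), "by Lemma 2.2 we know that Ch = Fitt"]
[cite: Skinner2016PacificMC, §2.3 (Lemma `F^Σ_L(f) = Ch^Σ_L(f)`)] -/
theorem fittingIdeal_zero_eq_charIdeal_of_forall_length (M : Type) [AddCommGroup M]
    [Module (IwasawaAlgebra p) M] [Module.Finite (IwasawaAlgebra p) M]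
    (htors : Module.IsTorsion (IwasawaAlgebra p) M)
    (hM : ∀ N : Submodule (IwasawaAlgebra p) M, Module.length (IwasawaAlgebra p) N ≠ ⊤ → N = ⊥) :
    Module.fittingIdeal (IwasawaAlgebra p) M 0 = charIdeal (IwasawaAlgebra p) M :=
  (fittingIdeal_zero_eq_charIdeal_iff_isPrincipal htors).mpr
    (fittingIdeal_zero_isPrincipal_of_forall_length p M htors hM)

/-- **Hypothesis `hF` of the congruence skeleton in its printed form**: for a finite torsion
`Λ`-module `N` (`X^Σ_ac(A_{g_m})`) with no nonzero submodule of finite length (Lemma 2.2) and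
`char_Λ(N) = (L)` (Thm. 2.3 for `g_m`), `Fitt_Λ(N) = (L)`.
[cite: Castella2018Erratum, proof of Thm. 1.1 (p. 4)] -/
theorem fittingIdeal_zero_eq_span_of_charIdeal_eq_span_of_forall_length (N : Type) [AddCommGroup N]
    [Module (IwasawaAlgebra p) N] [Module.Finite (IwasawaAlgebra p) N]
    (htors : Module.IsTorsion (IwasawaAlgebra p) N)
    (hN : ∀ N' : Submodule (IwasawaAlgebra p) N, Module.length (IwasawaAlgebra p) N' ≠ ⊤ → N' = ⊥)
    {L : IwasawaAlgebra p} (hCh : charIdeal (IwasawaAlgebra p) N = Ideal.span {L}) :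
    Module.fittingIdeal (IwasawaAlgebra p) N 0 = Ideal.span {L} := by
  rw [fittingIdeal_zero_eq_charIdeal_of_forall_length p N htors hN, hCh]

end Summit.BirchSwinnertonDyer.Rank1Residual.X11b.CongruenceLimit

end
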